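/-
Copyright (c) 2026 the pub-hodgecm-mathlib formalisation cell (harness21).  Prover seat hodgecm-mathlib-K2Liu-p13 (g2), Track B «K2-LIT»,
#184♮ = hLiu418 = `stmt-HodgeConjecture-24832`; Road I v3 organ U1-CT-ind STAGE 2 (Q2), file F5-b (LEAD F0P6-plan (g14) 10:39:33Z ∕ 11:15:51Z «F4 → F5 → D-U1 stage 3 =»).
-/
import Summits.HodgeConjecture.HodgeConjecture.Theorems.K2LiuKlingenCellXiOrbits          -- ★ F4-3b: `mk_transport_eq_mk_transport_iff` (+ ★ F4, F4-3a, F4-1c)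
import Summits.HodgeConjecture.HodgeConjecture.Theorems.K2LiuKlingenConjUnipotent          -- ★ F4-1d: `mk_transport_klingen_mul_nKlingen`
import HarnessLib

/-!
# Crux `HLiu418`, Road I v3, organ U1 stage 2 (Q2), file F5-b: THE IDENTITY CELL OF THE Q-CONSTANT TERM REINDEXED BY `B₂(L⁺)\U(J₂)(L⁺)` —
# `C₁ ≅ B₂(L⁺)\U(J₂)(L⁺)`, `Σ'_{x ∈ C₁} f(γ_x h) = Σ'_{[g′]} f(Ψ(m_Q(1,g′)) h)`

Cell `hodgecm-mathlib`, crux item hLiu418 = `stmt-HodgeConjecture-24832`; squad K2 ∕ K2Liu; LEAD F0P6-plan (g14), co-dealer K2E5-plan (g7); prover K2Liu-p13 (g2).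
THEOREMS ONLY (no `def`, no instance, no notation, no named-fact hypothesis, no `sorry`); lane `--supports stmt-HodgeConjecture-24832 --as helper` (count-neutral).
`n = 2`; ★ F3's transport clauses BY VALUE (section variables).  The identity cell `C₁ = {⟦Ψ(q)⟧ : q ∈ Q(L⁺)}` of ★ F4 `klingenConstTerm_two_cells` (membership law BY VALUE)
contributes `(∫ β dνN) • Σ'_{x ∈ C₁} f(γ_x h)`; this file identifies its index set with E1's Borel coset space of `U(J₂)` = `U(Φ₂)`, read through a ROW SECTION
`g : I → U(J₂)(L⁺)` of `B₂(L⁺)\U(J₂)(L⁺)` (`hcov`: every `g′` is `B₂`-equivalent to some `g i`; `hsep`: distinct indices are inequivalent):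
* §1 `mk_transport_klingenLevi_eq_iff` — `⟦Ψ(m_Q(1,g′))⟧ = ⟦Ψ(m_Q(1,g″))⟧ ⟺ (g′ g″⁻¹)₁₀ = 0` (★ F1 `klingenLevi_mem_siegelFour_iff`); `mk_transport_klingen_eq_mk_klingenLevi_one` —
  `⟦Ψ(q)⟧ = ⟦Ψ(m_Q(1, q|_{⟨e₁,e₂⟩}))⟧` for `q ∈ Q(L⁺)` (★ F4-3a Levi decomposition, ★ F4-1d: `N_Q(L⁺)` and the `GL₁`-factor `m_Q(a,1) ∈ P(L⁺)` are invisible);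
* §2 **`exists_equiv_cellOne`** — the bijection `I ≃ ↥C₁`, `i ↦ ⟦Ψ(m_Q(1, g i))⟧` (with its value equation); **`tsum_cellOne_eq_tsum`** —
  `Σ'_{x ∈ C₁} f(γ_x h) = Σ' i, f(Ψ(m_Q(1, g i)) · h)` for every Siegel section `f` (`Equiv.tsum_eq`, ★ O41.4 (b) `apply_out_mk_mul`), and `summable_cellOne_iff`.
With ★ F5-a `hasSum_cellXi` both cells of the Q-constant term are now sums over the SAME index `B₂(L⁺)\U(J₂)(L⁺)` — the index of E1's Borel Eisenstein series of `U(Φ₂)`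
(file F5: `E_Q = vol·E^{(1)}(s+½; i^*f) + vol′·E^{(1)}(s−½; i^*M(ξ,s)f)` after the `u₊`-integration and the exponent bookkeeping).
[MoeglinWaldspurger1995, II.1.7], [Xiong2013, §4 Prop. 4.1, §7 L. 7.1], [GanTakeda2011SiegelWeil, §7.2 p. 23], [Casselman1980, §3].
HONEST LABEL.  Count-neutral helper: `HC_CM` is proved only modulo the 7 printed citations (2 remaining named inputs: hLiu418 = `stmt-HodgeConjecture-24832`,
h413 = `stmt-HodgeConjecture-24833`) until rung 0 closes.
-/

set_option autoImplicit false
set_option linter.dupNamespace false -- the mandated namespace repeats `HodgeConjecture.HodgeConjecture`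

noncomputable section

open scoped Matrix
open NumberField IsDedekindDomain

namespace Summit.HodgeConjecture.HodgeConjecture.Cruxes.HLiu418.K2LiuKlingenCellOneSum

open Literature.NumberTheory.Automorphic Literature.NumberTheory.Automorphic.UnitaryGroup
open Literature.NumberTheory.GelbartRogawski1991 Literature.NumberTheory.GelbartRogawski1991.GRConstruction
open Literature.NumberTheory.GaloisRepresentations
open Literature.NumberTheory.K2Lit.SiegelDoubled
open Summit.HodgeConjecture.HodgeConjecture.Cruxes.HLiu418.K2LiuDoubledUTwoTwoBorelFrame
open Summit.HodgeConjecture.HodgeConjecture.Cruxes.HLiu418.K2LiuKlingenParabolicDefs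
open Summit.HodgeConjecture.HodgeConjecture.Cruxes.HLiu418.K2LiuKlingenUnipotentDefs
open Summit.HodgeConjecture.HodgeConjecture.Cruxes.HLiu418.K2LiuKlingenUnipotentAdelicDefs
open Summit.HodgeConjecture.HodgeConjecture.Cruxes.HLiu418.K2LiuKlingenRationalCells
open Summit.HodgeConjecture.HodgeConjecture.Cruxes.HLiu418.K2LiuKlingenConjUnipotent (mk_transport_klingen_mul_nKlingen)
open Summit.HodgeConjecture.HodgeConjecture.Cruxes.HLiu418.K2LiuKlingenLeviDecomposition
open Summit.HodgeConjecture.HodgeConjecture.Cruxes.HLiu418.K2LiuKlingenCellXiOrbits (mk_transport_eq_mk_transport_iff)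
open Summit.HodgeConjecture.HodgeConjecture.Cruxes.HLiu418.K2LiuConstantTermBigCellUnfold (apply_out_mk_mul)
open UnitaryDualPair

variable {L : Type} [Field L] [NumberField L] [IsCMField L]
variable {N M : ℕ} {e : Fin N × Fin M ≃ Fin 2}
  {dV : Fin N → L} {hdV : ∀ i, IsCMField.complexConj L (dV i) = dV i}
  {dW : Fin M → L} {hdW : ∀ i, IsCMField.complexConj L (dW i) = dW i}

section Transport

variable {SA : GL (Fin (2 + 2)) (AdeleRing (𝓞 L) L)}
  {Ψ : (quasiSplit (Fp L) L (IsCMField.complexConj L) (2 + 2)).Adelic ≃ₜ* HA L e dV hdV dW hdW} {X Y : Matrix (Fin 2) (Fin 2) (Fp L)} {a : Fp L}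
  (hΨ : ∀ g : (quasiSplit (Fp L) L (IsCMField.complexConj L) (2 + 2)).Adelic,
    (((Ψ g : HA L e dV hdV dW hdW) : GL (Fin (2 + 2)) (AdeleRing (𝓞 L) L)) : Matrix (Fin (2 + 2)) (Fin (2 + 2)) (AdeleRing (𝓞 L) L)) =
      (SA : Matrix (Fin (2 + 2)) (Fin (2 + 2)) (AdeleRing (𝓞 L) L)) *
        ((adelicVal (Fp L) L (IsCMField.complexConj L) (2 + 2) _ g : GL (Fin (2 + 2)) (AdeleRing (𝓞 L) L)) :
          Matrix (Fin (2 + 2)) (Fin (2 + 2)) (AdeleRing (𝓞 L) L)) *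
        ((SA⁻¹ : GL (Fin (2 + 2)) (AdeleRing (𝓞 L) L)) : Matrix (Fin (2 + 2)) (Fin (2 + 2)) (AdeleRing (𝓞 L) L)))
  (ha : a + a = 1)
  (hSA : Matrix.reindex (e₂ (n := 2)).symm (e₂ (n := 2)).symm (SA : Matrix (Fin (2 + 2)) (Fin (2 + 2)) (AdeleRing (𝓞 L) L)) =
    Matrix.fromBlocks (1 : Matrix (Fin 2) (Fin 2) (AdeleRing (𝓞 L) L)) (X.map ((algebraMap L (AdeleRing (𝓞 L) L)).comp (algebraMap (Fp L) L))) 1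
      (-(X.map ((algebraMap L (AdeleRing (𝓞 L) L)).comp (algebraMap (Fp L) L)))))
  (hSAi : Matrix.reindex (e₂ (n := 2)).symm (e₂ (n := 2)).symm ((SA⁻¹ : GL (Fin (2 + 2)) (AdeleRing (𝓞 L) L)) : Matrix (Fin (2 + 2)) (Fin (2 + 2)) (AdeleRing (𝓞 L) L)) =
    Matrix.fromBlocks ((a • (1 : Matrix (Fin 2) (Fin 2) (Fp L))).map ((algebraMap L (AdeleRing (𝓞 L) L)).comp (algebraMap (Fp L) L)))
      ((a • (1 : Matrix (Fin 2) (Fin 2) (Fp L))).map ((algebraMap L (AdeleRing (𝓞 L) L)).comp (algebraMap (Fp L) L)))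
      (Y.map ((algebraMap L (AdeleRing (𝓞 L) L)).comp (algebraMap (Fp L) L)))
      (-(Y.map ((algebraMap L (AdeleRing (𝓞 L) L)).comp (algebraMap (Fp L) L)))))
  (hXY : X * Y = a • (1 : Matrix (Fin 2) (Fin 2) (Fp L))) (hYX : Y * X = a • (1 : Matrix (Fin 2) (Fin 2) (Fp L)))

/-! ## §1 Classes of Klingen Levi letters -/

include hΨ ha hSA hSAi hYX in
/-- **`⟦Ψ(m_Q(1,g′))⟧ = ⟦Ψ(m_Q(1,g″))⟧ ⟺ (g′ g″⁻¹)₁₀ = 0`** (`m_Q(1,g′) m_Q(1,g″)⁻¹ = m_Q(1, g′g″⁻¹) ∈ P ⟺` corner test, ★ F1 `klingenLevi_mem_siegelFour_iff`): the identity-cell classes of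
the Levi letters are E1's Borel cosets `B₂ g′`. [cite: MoeglinWaldspurger1995, II.1.7] [cite: Xiong2013, §7 Lemma 7.1] -/
theorem mk_transport_klingenLevi_eq_iff (g' g'' : unitaryGroupOfForm ((IsCMField.complexConj L : L ≃ₐ[Fp L] L) : L →+* L) ((StdForm.antidiagonal 2).over L))
    (h' : Ψ (UnitaryGroup.toAdelic (Fp L) L (IsCMField.complexConj L) (2 + 2) ((StdForm.antidiagonal (2 + 2)).over L)
      (klingenLevi L ((IsCMField.complexConj L : L ≃ₐ[Fp L] L) : L →+* L) (complexConj_ringHom_apply_apply L) 1 g')) ∈ ratH L e dV hdV dW hdW)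
    (h'' : Ψ (UnitaryGroup.toAdelic (Fp L) L (IsCMField.complexConj L) (2 + 2) ((StdForm.antidiagonal (2 + 2)).over L)
      (klingenLevi L ((IsCMField.complexConj L : L ≃ₐ[Fp L] L) : L →+* L) (complexConj_ringHom_apply_apply L) 1 g'')) ∈ ratH L e dV hdV dW hdW) :
    (Quotient.mk (MulAction.orbitRel (siegelDeltaRat L e dV hdV dW hdW) (ratH L e dV hdV dW hdW)) ⟨_, h''⟩ : SiegelDeltaQuot L e dV hdV dW hdW) =
        Quotient.mk (MulAction.orbitRel (siegelDeltaRat L e dV hdV dW hdW) (ratH L e dV hdV dW hdW)) ⟨_, h'⟩ ↔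
      (((g' * g''⁻¹ : unitaryGroupOfForm ((IsCMField.complexConj L : L ≃ₐ[Fp L] L) : L →+* L) ((StdForm.antidiagonal 2).over L)) : GL (Fin 2) L) :
        Matrix (Fin 2) (Fin 2) L) 1 0 = 0 := by
  rw [mk_transport_eq_mk_transport_iff hΨ ha hSA hSAi hYX, klingenLevi_inv, inv_one, klingenLevi_mul, mul_one, klingenLevi_mem_siegelFour_iff]

include hΨ ha hSA hSAi hXY hYX in
/-- **`⟦Ψ(q)⟧ = ⟦Ψ(m_Q(1, g′))⟧` for `q = m_Q(a, g′) · n ∈ Q(L⁺)`** (★ F4-3a `exists_klingenLevi_mul_eq`): the unipotent part is invisible (★ F4-1d `mk_transport_klingen_mul_nKlingen`)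
and so is the `GL₁`-factor `m_Q(a,1) ∈ P(L⁺)`. [cite: Xiong2013, §4 Prop. 4.1] [cite: MoeglinWaldspurger1995, II.1.7] -/
theorem mk_transport_klingen_eq_mk_klingenLevi_one {q : unitaryGroupOfForm ((IsCMField.complexConj L : L ≃ₐ[Fp L] L) : L →+* L) ((StdForm.antidiagonal 4).over L)}
    (hq : q ∈ klingen L ((IsCMField.complexConj L : L ≃ₐ[Fp L] L) : L →+* L)) :
    ∃ (g' : unitaryGroupOfForm ((IsCMField.complexConj L : L ≃ₐ[Fp L] L) : L →+* L) ((StdForm.antidiagonal 2).over L)),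
      ((g' : GL (Fin 2) L) : Matrix (Fin 2) (Fin 2) L) =
        !![((q : GL (Fin 4) L) : Matrix (Fin 4) (Fin 4) L) 1 1, ((q : GL (Fin 4) L) : Matrix (Fin 4) (Fin 4) L) 1 2;
          ((q : GL (Fin 4) L) : Matrix (Fin 4) (Fin 4) L) 2 1, ((q : GL (Fin 4) L) : Matrix (Fin 4) (Fin 4) L) 2 2] ∧
      (Quotient.mk (MulAction.orbitRel (siegelDeltaRat L e dV hdV dW hdW) (ratH L e dV hdV dW hdW))
          ⟨Ψ (UnitaryGroup.toAdelic (Fp L) L (IsCMField.complexConj L) (2 + 2) ((StdForm.antidiagonal (2 + 2)).over L) q),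
            transport_toAdelic_mem_ratH hΨ ha hSA hSAi hXY hYX q⟩ : SiegelDeltaQuot L e dV hdV dW hdW) =
        Quotient.mk (MulAction.orbitRel (siegelDeltaRat L e dV hdV dW hdW) (ratH L e dV hdV dW hdW))
          ⟨Ψ (UnitaryGroup.toAdelic (Fp L) L (IsCMField.complexConj L) (2 + 2) ((StdForm.antidiagonal (2 + 2)).over L)
            (klingenLevi L ((IsCMField.complexConj L : L ≃ₐ[Fp L] L) : L →+* L) (complexConj_ringHom_apply_apply L) 1 g')),
            transport_toAdelic_mem_ratH hΨ ha hSA hSAi hXY hYX _⟩ := by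
  obtain ⟨a', g', n, hn, -, hg', hqmn⟩ := exists_klingenLevi_mul_eq (complexConj_ringHom_apply_apply L) hq
  refine ⟨g', hg', ?_⟩
  -- `⟦Ψ(m n)⟧ = ⟦Ψ m⟧` (★ F4-1d), then `⟦Ψ(m_Q(a,g′))⟧ = ⟦Ψ(m_Q(1,g′))⟧` (`m_Q(1,g′) m_Q(a,g′)⁻¹ = m_Q(a⁻¹,1) ∈ P`)
  have h1 : (Quotient.mk (MulAction.orbitRel (siegelDeltaRat L e dV hdV dW hdW) (ratH L e dV hdV dW hdW))
          ⟨Ψ (UnitaryGroup.toAdelic (Fp L) L (IsCMField.complexConj L) (2 + 2) ((StdForm.antidiagonal (2 + 2)).over L) q),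
            transport_toAdelic_mem_ratH hΨ ha hSA hSAi hXY hYX q⟩ : SiegelDeltaQuot L e dV hdV dW hdW) =
        Quotient.mk (MulAction.orbitRel (siegelDeltaRat L e dV hdV dW hdW) (ratH L e dV hdV dW hdW))
          ⟨Ψ (UnitaryGroup.toAdelic (Fp L) L (IsCMField.complexConj L) (2 + 2) ((StdForm.antidiagonal (2 + 2)).over L)
            (klingenLevi L ((IsCMField.complexConj L : L ≃ₐ[Fp L] L) : L →+* L) (complexConj_ringHom_apply_apply L) a' g')),
            transport_toAdelic_mem_ratH hΨ ha hSA hSAi hXY hYX _⟩ := by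
    have h := mk_transport_klingen_mul_nKlingen hΨ ha hSA hSAi hXY hYX (klingenLevi_mem_klingen (complexConj_ringHom_apply_apply L) a' g') hn
    refine Eq.trans ?_ h
    congr 1
    exact Subtype.ext (by rw [hqmn])
  rw [h1]
  refine (mk_transport_eq_mk_transport_iff hΨ ha hSA hSAi hYX _ _ _ _).2 ?_
  rw [klingenLevi_inv, klingenLevi_mul, one_mul, mul_inv_cancel]
  exact (klingenLevi_mem_siegelFour_iff _ _ _).2 (by simp)

/-! ## §2 `C₁ ≃ B₂(L⁺)\U(J₂)(L⁺)` along a row section, and the reindexed identity-cell sum -/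

include hΨ ha hSA hSAi hXY hYX in
/-- **THE IDENTITY CELL IS IN BIJECTION WITH `B₂(L⁺)\U(J₂)(L⁺)`**: for a row section `g : I → U(J₂)(L⁺)` (`hcov`, `hsep`) there is `ε : I ≃ ↥C₁` with `ε i = ⟦Ψ(m_Q(1, g i))⟧`.
[cite: MoeglinWaldspurger1995, II.1.7] [cite: Xiong2013, §7 Lemma 7.1] [cite: Casselman1980, §3] -/
theorem exists_equiv_cellOne (C₁ : Set (SiegelDeltaQuot L e dV hdV dW hdW))
    (hC₁ : ∀ x, x ∈ C₁ ↔ ∃ q ∈ klingen L ((IsCMField.complexConj L : L ≃ₐ[Fp L] L) : L →+* L), ∃ γ : ratH L e dV hdV dW hdW,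
      (γ : HA L e dV hdV dW hdW) = Ψ (UnitaryGroup.toAdelic (Fp L) L (IsCMField.complexConj L) (2 + 2) ((StdForm.antidiagonal (2 + 2)).over L) q) ∧
        x = Quotient.mk (MulAction.orbitRel (siegelDeltaRat L e dV hdV dW hdW) (ratH L e dV hdV dW hdW)) γ)
    {I : Type*} (g : I → unitaryGroupOfForm ((IsCMField.complexConj L : L ≃ₐ[Fp L] L) : L →+* L) ((StdForm.antidiagonal 2).over L))
    (hcov : ∀ g' : unitaryGroupOfForm ((IsCMField.complexConj L : L ≃ₐ[Fp L] L) : L →+* L) ((StdForm.antidiagonal 2).over L),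
      ∃ i, (((g' * (g i)⁻¹ : unitaryGroupOfForm ((IsCMField.complexConj L : L ≃ₐ[Fp L] L) : L →+* L) ((StdForm.antidiagonal 2).over L)) : GL (Fin 2) L) :
        Matrix (Fin 2) (Fin 2) L) 1 0 = 0)
    (hsep : ∀ i j, (((g j * (g i)⁻¹ : unitaryGroupOfForm ((IsCMField.complexConj L : L ≃ₐ[Fp L] L) : L →+* L) ((StdForm.antidiagonal 2).over L)) : GL (Fin 2) L) :
        Matrix (Fin 2) (Fin 2) L) 1 0 = 0 → i = j) :
    ∃ ε : I ≃ ↥C₁, ∀ i, ((ε i : ↥C₁) : SiegelDeltaQuot L e dV hdV dW hdW) =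
      Quotient.mk (MulAction.orbitRel (siegelDeltaRat L e dV hdV dW hdW) (ratH L e dV hdV dW hdW))
        ⟨Ψ (UnitaryGroup.toAdelic (Fp L) L (IsCMField.complexConj L) (2 + 2) ((StdForm.antidiagonal (2 + 2)).over L)
          (klingenLevi L ((IsCMField.complexConj L : L ≃ₐ[Fp L] L) : L →+* L) (complexConj_ringHom_apply_apply L) 1 (g i))),
          transport_toAdelic_mem_ratH hΨ ha hSA hSAi hXY hYX _⟩ := by
  classical
  -- the map `i ↦ ⟦Ψ(m_Q(1, g i))⟧ ∈ C₁`
  have hmem : ∀ i, (Quotient.mk (MulAction.orbitRel (siegelDeltaRat L e dV hdV dW hdW) (ratH L e dV hdV dW hdW))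
        ⟨Ψ (UnitaryGroup.toAdelic (Fp L) L (IsCMField.complexConj L) (2 + 2) ((StdForm.antidiagonal (2 + 2)).over L)
          (klingenLevi L ((IsCMField.complexConj L : L ≃ₐ[Fp L] L) : L →+* L) (complexConj_ringHom_apply_apply L) 1 (g i))),
          transport_toAdelic_mem_ratH hΨ ha hSA hSAi hXY hYX _⟩ : SiegelDeltaQuot L e dV hdV dW hdW) ∈ C₁ := fun i =>
    (hC₁ _).2 ⟨_, klingenLevi_mem_klingen _ 1 (g i), _, rfl, rfl⟩
  set F : I → ↥C₁ := fun i => ⟨_, hmem i⟩ with hF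
  have hFinj : Function.Injective F := by
    intro i j hij
    have hij' := congrArg (fun x : ↥C₁ => (x : SiegelDeltaQuot L e dV hdV dW hdW)) hij
    simp only [hF] at hij'
    exact hsep i j ((mk_transport_klingenLevi_eq_iff hΨ ha hSA hSAi hYX (g j) (g i) _ _).1 hij')
  have hFsurj : Function.Surjective F := by
    rintro ⟨x, hx⟩
    obtain ⟨q, hq, γ, hγ, rfl⟩ := (hC₁ x).1 hx
    obtain ⟨g', -, hcls⟩ := mk_transport_klingen_eq_mk_klingenLevi_one hΨ ha hSA hSAi hXY hYX hq
    obtain ⟨i, hi⟩ := hcov g'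
    refine ⟨i, Subtype.ext ?_⟩
    simp only [hF]
    have hγ' : γ = ⟨Ψ (UnitaryGroup.toAdelic (Fp L) L (IsCMField.complexConj L) (2 + 2) ((StdForm.antidiagonal (2 + 2)).over L) q),
        transport_toAdelic_mem_ratH hΨ ha hSA hSAi hXY hYX q⟩ := Subtype.ext hγ
    rw [hγ', hcls]
    exact (mk_transport_klingenLevi_eq_iff hΨ ha hSA hSAi hYX g' (g i) _ _).2 hi
  exact ⟨Equiv.ofBijective F ⟨hFinj, hFsurj⟩, fun i => rfl⟩

include hΨ ha hSA hSAi hXY hYX in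
/-- **(Q2) F5-b — THE IDENTITY-CELL SUM REINDEXED BY `B₂(L⁺)\U(J₂)(L⁺)`**: for a Siegel section `f` of `I_Δ(s,χ)`, `h ∈ H(𝔸)` and a row section `g` (`hcov`, `hsep`),
  `Σ'_{x ∈ C₁} f(γ_x · h) = Σ'_i f(Ψ(m_Q(1, g i)) · h)`
(`Equiv.tsum_eq` along `exists_equiv_cellOne`; representative independence ★ O41.4 (b) `apply_out_mk_mul`).  The right side is the index form of E1's Borel Eisenstein sum of
the restricted section `g′ ↦ f(Ψ(m_Q(1,g′)) h)` (file F5). [cite: MoeglinWaldspurger1995, II.1.7] [cite: Xiong2013, §4 Prop. 4.1] [cite: GanTakeda2011SiegelWeil, §7.2 p. 23] -/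
theorem tsum_cellOne_eq_tsum (C₁ : Set (SiegelDeltaQuot L e dV hdV dW hdW))
    (hC₁ : ∀ x, x ∈ C₁ ↔ ∃ q ∈ klingen L ((IsCMField.complexConj L : L ≃ₐ[Fp L] L) : L →+* L), ∃ γ : ratH L e dV hdV dW hdW,
      (γ : HA L e dV hdV dW hdW) = Ψ (UnitaryGroup.toAdelic (Fp L) L (IsCMField.complexConj L) (2 + 2) ((StdForm.antidiagonal (2 + 2)).over L) q) ∧
        x = Quotient.mk (MulAction.orbitRel (siegelDeltaRat L e dV hdV dW hdW) (ratH L e dV hdV dW hdW)) γ)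
    {I : Type*} (g : I → unitaryGroupOfForm ((IsCMField.complexConj L : L ≃ₐ[Fp L] L) : L →+* L) ((StdForm.antidiagonal 2).over L))
    (hcov : ∀ g' : unitaryGroupOfForm ((IsCMField.complexConj L : L ≃ₐ[Fp L] L) : L →+* L) ((StdForm.antidiagonal 2).over L),
      ∃ i, (((g' * (g i)⁻¹ : unitaryGroupOfForm ((IsCMField.complexConj L : L ≃ₐ[Fp L] L) : L →+* L) ((StdForm.antidiagonal 2).over L)) : GL (Fin 2) L) :
        Matrix (Fin 2) (Fin 2) L) 1 0 = 0)
    (hsep : ∀ i j, (((g j * (g i)⁻¹ : unitaryGroupOfForm ((IsCMField.complexConj L : L ≃ₐ[Fp L] L) : L →+* L) ((StdForm.antidiagonal 2).over L)) : GL (Fin 2) L) :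
        Matrix (Fin 2) (Fin 2) L) 1 0 = 0 → i = j)
    {χ : HeckeCharacter L} {s : ℂ} {f : HA L e dV hdV dW hdW → ℂ} (hf : IsSiegelDeltaSection L e dV hdV dW hdW χ s f) (h : HA L e dV hdV dW hdW) :
    ∑' x : C₁, f ((((Quotient.out (x : SiegelDeltaQuot L e dV hdV dW hdW) : ratH L e dV hdV dW hdW) : HA L e dV hdV dW hdW)) * h) =
      ∑' i, f (Ψ (UnitaryGroup.toAdelic (Fp L) L (IsCMField.complexConj L) (2 + 2) ((StdForm.antidiagonal (2 + 2)).over L)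
        (klingenLevi L ((IsCMField.complexConj L : L ≃ₐ[Fp L] L) : L →+* L) (complexConj_ringHom_apply_apply L) 1 (g i))) * h) := by
  obtain ⟨ε, hε⟩ := exists_equiv_cellOne hΨ ha hSA hSAi hXY hYX C₁ hC₁ g hcov hsep
  rw [← ε.tsum_eq]
  refine tsum_congr fun i => ?_
  rw [hε i]
  exact apply_out_mk_mul hf _ h

include hΨ ha hSA hSAi hXY hYX in
/-- **… with the summability transferred**: `Summable (i ↦ f(Ψ(m_Q(1, g i)) h)) ↔ Summable (x ∈ C₁ ↦ f(γ_x h))`. [cite: MoeglinWaldspurger1995, II.1.7] -/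
theorem summable_cellOne_iff (C₁ : Set (SiegelDeltaQuot L e dV hdV dW hdW))
    (hC₁ : ∀ x, x ∈ C₁ ↔ ∃ q ∈ klingen L ((IsCMField.complexConj L : L ≃ₐ[Fp L] L) : L →+* L), ∃ γ : ratH L e dV hdV dW hdW,
      (γ : HA L e dV hdV dW hdW) = Ψ (UnitaryGroup.toAdelic (Fp L) L (IsCMField.complexConj L) (2 + 2) ((StdForm.antidiagonal (2 + 2)).over L) q) ∧
        x = Quotient.mk (MulAction.orbitRel (siegelDeltaRat L e dV hdV dW hdW) (ratH L e dV hdV dW hdW)) γ)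
    {I : Type*} (g : I → unitaryGroupOfForm ((IsCMField.complexConj L : L ≃ₐ[Fp L] L) : L →+* L) ((StdForm.antidiagonal 2).over L))
    (hcov : ∀ g' : unitaryGroupOfForm ((IsCMField.complexConj L : L ≃ₐ[Fp L] L) : L →+* L) ((StdForm.antidiagonal 2).over L),
      ∃ i, (((g' * (g i)⁻¹ : unitaryGroupOfForm ((IsCMField.complexConj L : L ≃ₐ[Fp L] L) : L →+* L) ((StdForm.antidiagonal 2).over L)) : GL (Fin 2) L) :
        Matrix (Fin 2) (Fin 2) L) 1 0 = 0)
    (hsep : ∀ i j, (((g j * (g i)⁻¹ : unitaryGroupOfForm ((IsCMField.complexConj L : L ≃ₐ[Fp L] L) : L →+* L) ((StdForm.antidiagonal 2).over L)) : GL (Fin 2) L) :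
        Matrix (Fin 2) (Fin 2) L) 1 0 = 0 → i = j)
    {χ : HeckeCharacter L} {s : ℂ} {f : HA L e dV hdV dW hdW → ℂ} (hf : IsSiegelDeltaSection L e dV hdV dW hdW χ s f) (h : HA L e dV hdV dW hdW) :
    Summable (fun i => f (Ψ (UnitaryGroup.toAdelic (Fp L) L (IsCMField.complexConj L) (2 + 2) ((StdForm.antidiagonal (2 + 2)).over L)
        (klingenLevi L ((IsCMField.complexConj L : L ≃ₐ[Fp L] L) : L →+* L) (complexConj_ringHom_apply_apply L) 1 (g i))) * h)) ↔
      Summable (fun x : C₁ => f ((((Quotient.out (x : SiegelDeltaQuot L e dV hdV dW hdW) : ratH L e dV hdV dW hdW) : HA L e dV hdV dW hdW)) * h)) := by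
  obtain ⟨ε, hε⟩ := exists_equiv_cellOne hΨ ha hSA hSAi hXY hYX C₁ hC₁ g hcov hsep
  have hfun : (fun i => f (Ψ (UnitaryGroup.toAdelic (Fp L) L (IsCMField.complexConj L) (2 + 2) ((StdForm.antidiagonal (2 + 2)).over L)
      (klingenLevi L ((IsCMField.complexConj L : L ≃ₐ[Fp L] L) : L →+* L) (complexConj_ringHom_apply_apply L) 1 (g i))) * h)) =
      (fun x : C₁ => f ((((Quotient.out (x : SiegelDeltaQuot L e dV hdV dW hdW) : ratH L e dV hdV dW hdW) : HA L e dV hdV dW hdW)) * h)) ∘ ε := by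
    funext i
    simp only [Function.comp_apply]
    rw [hε i, apply_out_mk_mul hf _ h]
  rw [hfun]
  exact ε.summable_iff

end Transport

end Summit.HodgeConjecture.HodgeConjecture.Cruxes.HLiu418.K2LiuKlingenCellOneSum

end
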